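import Literature.AlgebraicGeometry.ComplexMultiplication.CyclotomicFermatCMTypesPrimePowerAllTriples
import HarnessLib

/-!
# Koblitz–Rohrlich §3 PROPOSITION, CASE 1, at every level `N` prime to `6`: `H_{(r,s,t)} = H_{(r′,s′,t′)}` and `p ∣ r, s, t`
# force `p ∣ r′, s′, t′` — hence (v2, §6) the level `M = N/g.c.d.(N, r, s, t)` is an invariant of `H` and of the isogeny class

Layer `Literature/AlgebraicGeometry/ComplexMultiplication`, namespace `…ComplexMultiplication.CyclotomicFermatCMType`; sequel of
`CyclotomicFermatCMTypesPrimePowerCoincidences` ∕ `…PrimePowerAllTriples` (gen 37: Theorem 1 with the boundary cases at PRIME-POWER level,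
by the parity criterion) and of `CyclotomicFermatCMTypesOddTwoPrimeLevel*` (gens 35–36: composite levels in the relatively prime case; the
boundary cases "remain at `N = 35` by enumeration"), whose honest columns and the lane's DELIVERABLEs (gens 37–38 §5) list «§3 Proposition at
COMPOSITE `N` prime to `6` with g.c.d. > 1 ∕ boundary cases beyond `N = 35` — NOT typed; the parity road needs `B_{1,χ} ≠ 0` for all odd `χ`
(false at composite `N`)».  THIS FILE types CASE 1 of that Proposition by KOBLITZ–ROHRLICH'S OWN COMBINATORIAL ARGUMENT (no characters), at
every level `N` prime to `6`, and (v2, §6) iterates it down the levels: `H_τ = H_{τ′}` forces g.c.d.`(N, r, s, t)` = g.c.d.`(N, r′, s′, t′)`.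
THEOREMS ONLY (no definition, no named fact, no `sorry`, no kernel `decide`).

THE SOURCE.  N. Koblitz, D. Rohrlich, *Simple factors in the Jacobian of a Fermat curve*, Canad. J. Math. **30** (1978) 1183–1205 (held
`paper:koblitz1978-simple-factors-jacobian-fermat-curve`, pp. 1193–1195 read first-hand).  §3 (p. 1193): "PROPOSITION. Let `2, 3 ∤ N`,
`τ = (r, s, t)`, `τ′ = (r′, s′, t′)`, `r + s + t = N`. Suppose g.c.d.`(r, s, t, r′, s′, t′) = 1`. Let `H_τ = {h ∈ (ℤ/Nℤ)* | ⟨hr⟩ + ⟨hs⟩ +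
⟨ht⟩ = N}` and similarly for `H_{τ′}`. Suppose `N` is not prime to `rstr′s′t′` … Finally, suppose `H_τ = H_{τ′}`. Then `τ′` is a permutation
of `τ`.  Proof. Case 1. g.c.d.`(r, s, t, N) > 1`.  Let `p |` g.c.d.`(r, s, t, N)`, `p ≥ 5`. Let `P = 1 + (N/p)(ℤ/pℤ)`, `P* = P ∩ (ℤ/Nℤ)*`,
`ν = #(P∖P*)`. Then `ν = 0` if `p² | N`, `1` if `p² ∤ N`.  Since `⟨ur⟩ = r, ⟨us⟩ = s, ⟨ut⟩ = t` for `u ∈ P`, we have: `P* ⊂ H_τ = H_{τ′}`.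
Thus `Σ_{u∈P*} ⟨ur′⟩ + ⟨us′⟩ + ⟨ut′⟩ = (p − ν)N`.  Since `⟨ur′⟩ + ⟨us′⟩ + ⟨ut′⟩ = N` or `2N` for `u ∈ P∖P*`, we have
(3) `Σ_{u∈P} ⟨ur′⟩ + ⟨us′⟩ + ⟨ut′⟩ ≤ (p + ν)N`. … For `x` prime to `p`, note that `⟨ux⟩` runs through `⟨x⟩_{N/p} + iN/p`, `i = 0, 1, …,
p − 1`, as `u` runs through `P`.  First suppose `p ∤ r′, s′, t′`. Then `Σ_{u∈P} … = p(r₀′ + s₀′ + t₀′) + 3 Σ_{i=0}^{p−1} iN/p ≥ N + 3(p−1)N/2`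
… This contradicts (3) because `(p − 1)/2 ≥ 2 > ν`.  Now suppose, say, `p | r′`. Since g.c.d.`(r, s, t, r′, s′, t′) = 1`, we then have
`p ∤ s′, t′`. Note that if `τ` and `τ′` are replaced by `u₀τ` and `u₀τ′` … (3) can be replaced by (4) `Σ_{u∈P} … ≥ (2p − ν)N`. Since `p | r′`,
we have `Σ_{u∈P} … = pr′ + p(s₀′ + t₀′) + (p − 1)N`. We claim that `τ′` can be modified by a suitable `u₀ ∈ (ℤ/Nℤ)*` so that
`(p + ν)N < pr′ + p(s₀′ + t₀′) + (p − 1)N < (2p − ν)N`, contradicting (3) and (4). Since `0 < s₀′ + t₀′ < 2N/p`, we would like `r′` to satisfy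
`(ν + 1)N/p ≤ r′ ≤ N − (ν + 1)N/p`. It clearly suffices if `2N/5 ≤ r′ ≤ 3N/5`.  Let `x = g.c.d.(r′, N)`, `y = N/x`, `β = [log₂ y/√2]` … Now let
`u₁ ∈ (ℤ/Nℤ)*` equal either `2^β, 3·2^{β−1}`, or `3·2^{β−2}`, so that `2y/5 ≤ u₁ ≤ 3y/5`" (p. 1195: "… as required.").

## What is proved (level written `N = pQ`; `p ∣ x` for a residue `x` means `p ∣ ⟨x⟩`, the representative in `[0, N)`)

* §1 (the orbit `h₀P`, any `p, Q`): `orbit_mul_eq_of_dvd` (`h₀(1 + iQ)·x = h₀x` for `p ∣ x`), `val_orbit_mul_eq` and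
  **`two_mul_sum_val_orbit_mul`** ("`⟨ux⟩` runs through `⟨x⟩_{N/p} + iN/p`": `2Σ_{i<p} ⟨h₀(1 + iQ)x⟩ = 2p(⟨h₀x⟩ mod Q) + Qp(p − 1)` for
  `p ∤ ⟨h₀x⟩`), `sum_val_orbit_mul_of_dvd` (`= p⟨h₀x⟩` for `p ∣ x`), `two_mul_sum_affine_mod`; **`orbit_mem_fermatCMType_iff`** ("`P* ⊂ H_τ`":
  a unit of the orbit of `h₀` is in `H_τ` iff `h₀` is, for `p ∣ r, s, t`), `dvd_of_not_isUnit_orbit` and **`card_filter_not_isUnit_orbit_le_one`**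
  (`ν ≤ 1`), `val_orbit_mul_eq_zero`.
* §2 **`fermatCMType_ne_of_dvd_of_not_dvd`** — "First suppose `p ∤ r′, s′, t′`": for ANY `N = pQ` and prime `p ≥ 5` (`N` prime to `6` not
  needed), `p ∣ r, s, t`, `p ∤ r′, s′, t′` ⟹ `H_τ ≠ H_{τ′}`.
* §3 **`exists_smooth_mem_middle`** (for `y ≥ 5` one of `2^β, 3·2^{β−1}, 3·2^{β−2}` lies in `[2y/5, 3y/5]`, integer form) and
  **`exists_isUnit_val_mul_mem_middle`** (K–R's `u₀`: for `N` prime to `6` and `x ≠ 0` a unit `u` with `2N ≤ 5⟨ux⟩ ≤ 3N`; unit lifting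
  `(ℤ/N)ˣ → (ℤ/y)ˣ` is Mathlib's `ZMod.unitsMap_surjective`).
* §4 **`fermatCMType_ne_of_dvd_of_dvd_of_not_dvd`** — "Now suppose, say, `p | r′`": `N` prime to `6`, `p ∣ r, s, t, r′`, `p ∤ s′, t′` ⟹
  `H_τ ≠ H_{τ′}` (inequalities (3)/(4) against `(p + ν)N < Σ < (2p − ν)N`).
* §5 **`dvd_of_fermatCMType_eq_of_dvd`** = CASE 1: `N` prime to `6`, `p ≥ 5`, admissible `τ, τ′`, `H_τ = H_{τ′}`, `p ∣ r, s, t` ⟹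
  `p ∣ r′, s′, t′`; **`dvd_iff_dvd_of_fermatCMType_eq`** (both ways), `not_dvd_of_fermatCMType_eq` (Case 1 eliminated under
  g.c.d.`(r,s,t,r′,s′,t′) = 1`), `dvd_val_iff_of_add_eq_zero`; at any level `N` prime to `6` and any prime `p ∣ N`:
  **`dvd_iff_dvd_of_fermatCMType_eq_of_prime_dvd`**; ON ABELIAN VARIETIES: **`dvd_iff_dvd_of_isIsogenous`** — isogenous realisations of
  the full-level types `Φ_{H_τ}`, `Φ_{H_{τ′}}` of `ℚ(ζ_N)` have levels `M, M′` with the same prime divisors (Shimura–Taniyama, tree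
  `isIsogenous_fermatCMType_iff_exists_eq_mul`, + Case 1 for `uτ`).
* §6 (v2) **`gcd_dvd_gcd_of_fermatCMType_eq_nat`** (strong induction on `N`: a prime `p` of `gcd(N, a, b, c)` divides `a′, b′, c′` by Case 1,
  the equality of the `p`-multiple triples descends to level `N/p` by the sibling `fermatCMType_eq_of_fermatCMType_level_mul_eq`, and
  `gcd(pM, pa, pb, pc) = p·gcd(M, a, b, c)`); **`gcd_eq_gcd_of_fermatCMType_eq`** — THE LEVEL IS AN INVARIANT OF `H`: at `N` prime to `6`,
  `H_τ = H_{τ′}` ⟹ g.c.d.`(N, r, s, t)` = g.c.d.`(N, r′, s′, t′)` (same `M`, so K–R's `L_τ, L_{τ′}` lie in the same `ℂ^{φ(M)/2}` over the same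
  `ℚ(ζ_M)`); **`gcd_eq_gcd_of_isIsogenous`** — THE LEVEL IS AN ISOGENY INVARIANT of the full-level varieties (with the sibling
  `CyclotomicFermatCMTypesLevelOnVarieties.exists_isIsogeny_power_level_mul`: both are `φ(N)/φ(M)`-th powers of `φ(M)/2`-dimensional ones).

## Honest column / NOT here

* Only CASE 1 of the §3 Proposition.  Cases 2–3 (pp. 1195–1197: a prime dividing `N` and some but not all entries of ONE triple — the
  "boundary" triples proper —, with K–R's omitted Lemma, the omitted "tedious examination" at `p = 5` and the hand check `N = 35`) are NOT
  typed; hence Theorem 1 at composite `N` with g.c.d. > 1 entries is still open in the tree beyond prime powers (gen 37) and `N = 35` (gen 36).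
* The argument is K–R's, reorganised around an ARBITRARY `h₀ ∈ H_τ` (instead of the normalisation "`1 ∈ H_τ`, else replace (3) by (4)"),
  which makes the two sub-cases uniform; K–R's tacit non-vanishing facts are proved where used: in §2 the corner `r₀′ + s₀′ + t₀′ = 0` (all of
  `r′, s′, t′` divisible by `Q`, where the printed "`≥ N + 3(p−1)N/2`" fails) is closed by computing the non-unit point's contribution (`0`,
  not `≤ 2N`); in §4 "`0 < s₀′ + t₀′`" and "`= N` or `2N` on `P∖P*`" are derived (`hY_lo`, `hpos`).
* `p ∣ x` is read on representatives (`p ∣ x.val`, meaningful as `p ∣ N`); "g.c.d.`(r, s, t, r′, s′, t′) = 1`" enters only through its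
  consequence "`p` does not divide all six" (`not_dvd_of_fermatCMType_eq`); the level is read as g.c.d.`(N, ⟨r⟩, ⟨s⟩, ⟨t⟩)` (`Nat.gcd` nested),
  K–R's `N/M`.  The equality of levels (§6) is a consequence K–R do not print as such (for them it is built into "`{r,s,t} ∼ {r′,s′,t′}`" and
  `dim L_τ = φ(M)/2`); it is what Case 1 gives when iterated.
* §2 holds for every `N` (even or not); §§3–5 use `N` prime to `6` exactly where K–R do (the units `2^β, 3·2^{β−1}, 3·2^{β−2}` and `y ≥ 5`).

## References

* [KoblitzRohrlich1978] N. Koblitz, D. Rohrlich, Canad. J. Math. 30 (1978) 1183–1205: §1 (pp. 1183–1185), §3 Proposition, Case 1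
  (pp. 1193–1195).
* [Shimura1998] G. Shimura, *Abelian Varieties with Complex Multiplication and Modular Functions* (1998), §6.1 Corollary, §8.4 Example (1)
  (through `CyclotomicCMTypeIsogenyClasses` ∕ `CyclotomicFermatCMTypesPrimePowerIsogenies`).

## Provenance

Cell `pub-hodgecm2` (COR-CM), literature seat `lit-deligne-3` gen 39 (claim KR78-BOUNDARY-CASE1; count-neutral, own lane).
-/

namespace Literature.AlgebraicGeometry.ComplexMultiplication

open Literature.AlgebraicGeometry.HodgeTheory (fermatCMType)
open Finset

namespace CyclotomicFermatCMType

/-! ## §1 The orbit `h₀·P`, `P = 1 + (N/p)·ℤ/p`, and the sums `Σ_{u ∈ P} ⟨u x⟩` -/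

section Orbit

variable {p Q : ℕ}

/-- For `p ∣ x` (on representatives) the orbit `h₀(1 + iQ)` fixes `x`: `h₀(1 + iQ)·x = h₀x` modulo `N = pQ`
("Since `⟨ur⟩ = r, ⟨us⟩ = s, ⟨ut⟩ = t` for `u ∈ P`"). [cite: KoblitzRohrlich1978, §3 Case 1 (p. 1193)] -/
theorem orbit_mul_eq_of_dvd [NeZero (p * Q)] (h₀ x : ZMod (p * Q)) (hx : p ∣ x.val) (i : ℕ) :
    h₀ * (1 + (i : ZMod (p * Q)) * (Q : ZMod (p * Q))) * x = h₀ * x := by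
  obtain ⟨m, hm⟩ := hx
  have hQx : (Q : ZMod (p * Q)) * x = 0 := by
    conv_lhs => rw [← ZMod.natCast_zmod_val x, hm]
    rw [← Nat.cast_mul, ZMod.natCast_eq_zero_iff]
    exact ⟨m, by ring⟩
  rw [mul_assoc, add_mul, one_mul, mul_assoc, hQx, mul_zero, add_zero]

/-- The representative of `h₀(1 + iQ)·x` for `p ∤ ⟨h₀x⟩`: writing `a = ⟨h₀x⟩ = a₀ + Q·a₁` (`a₀ < Q`, `a₁ < p`),
`⟨h₀(1 + iQ)x⟩ = a₀ + Q·((a₁ + i·a) mod p)` ("for `x` prime to `p`, `⟨ux⟩` runs through `⟨x⟩_{N/p} + iN/p`, `i = 0, 1, …, p − 1`,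
as `u` runs through `P`"). [cite: KoblitzRohrlich1978, §3 Case 1 (p. 1194)] -/
theorem val_orbit_mul_eq [NeZero (p * Q)] (hp : 0 < p) (h₀ x : ZMod (p * Q)) (i : ℕ) :
    (h₀ * (1 + (i : ZMod (p * Q)) * (Q : ZMod (p * Q))) * x).val =
      (h₀ * x).val % Q + Q * (((h₀ * x).val / Q + i * (h₀ * x).val) % p) := by
  have hQ : 0 < Q := Nat.pos_of_ne_zero fun h => NeZero.ne (p * Q) (by rw [h, mul_zero])
  set a := (h₀ * x).val with ha
  have key : h₀ * (1 + (i : ZMod (p * Q)) * (Q : ZMod (p * Q))) * x = ((a % Q + Q * ((a / Q + i * a) % p) : ℕ) : ZMod (p * Q)) := by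
    have e1 : h₀ * (1 + (i : ZMod (p * Q)) * (Q : ZMod (p * Q))) * x = ((a + i * Q * a : ℕ) : ZMod (p * Q)) := by
      rw [Nat.cast_add, ha, ZMod.natCast_zmod_val, Nat.cast_mul, Nat.cast_mul, ZMod.natCast_zmod_val]
      ring
    have e2 : a + i * Q * a = a % Q + Q * (a / Q + i * a) := by
      calc a + i * Q * a = (a % Q + Q * (a / Q)) + i * Q * a := by rw [Nat.mod_add_div a Q]
        _ = a % Q + Q * (a / Q + i * a) := by ring
    rw [e1, ZMod.natCast_eq_natCast_iff', e2]
    have hm : (a / Q + i * a) ≡ (a / Q + i * a) % p [MOD p] := (Nat.mod_modEq _ _).symm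
    have h2 := (Nat.ModEq.mul_left' Q hm).add_left (a % Q)
    rw [mul_comm p Q]
    exact h2
  rw [key, ZMod.val_natCast, Nat.mod_eq_of_lt]
  calc a % Q + Q * ((a / Q + i * a) % p) < Q + Q * ((a / Q + i * a) % p) := by
        have := Nat.mod_lt a hQ; omega
    _ ≤ Q + Q * (p - 1) := by
        have := Nat.mod_lt (a / Q + i * a) hp
        have : (a / Q + i * a) % p ≤ p - 1 := by omega
        exact Nat.add_le_add_left (Nat.mul_le_mul_left Q this) Q
    _ = p * Q := by
        obtain ⟨p', rfl⟩ : ∃ p', p = p' + 1 := ⟨p - 1, by omega⟩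
        rw [Nat.add_sub_cancel]; ring

/-- `i ↦ (c + i·a) mod p` is a permutation of `{0, …, p − 1}` when `p` is prime and `p ∤ a`. [folklore] -/
private theorem image_affine_mod_eq_range (hp : p.Prime) {a : ℕ} (ha : ¬p ∣ a) (c : ℕ) :
    (range p).image (fun i => (c + i * a) % p) = range p := by
  have hinj : Set.InjOn (fun i => (c + i * a) % p) (range p) := by
    intro i hi j hj hij
    simp only [coe_range, Set.mem_Iio] at hi hj
    have h1 : c + i * a ≡ c + j * a [MOD p] := hij
    have h2 : i * a ≡ j * a [MOD p] := Nat.ModEq.add_left_cancel' c h1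
    have hcop : Nat.Coprime p a := (Nat.Prime.coprime_iff_not_dvd hp).2 ha
    have h3 : i ≡ j [MOD p] := Nat.ModEq.cancel_right_of_coprime (by simpa [Nat.coprime_comm] using hcop.symm) h2
    exact Nat.ModEq.eq_of_lt_of_lt h3 hi hj
  apply eq_of_subset_of_card_le
  · intro y hy
    obtain ⟨i, -, rfl⟩ := mem_image.1 hy
    exact mem_range.2 (Nat.mod_lt _ hp.pos)
  · rw [card_image_of_injOn hinj]

/-- `2·Σ_{i<p} (a₀ + Q·((c + i a) mod p)) = 2p·a₀ + Q·p(p − 1)` for `p` prime, `p ∤ a` (the orbit sum of an entry prime to `p`: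
"`Σ_{u∈P} ⟨ux⟩ = p·x₀ + Σ_{i<p} iN/p`"). [cite: KoblitzRohrlich1978, §3 Case 1 (p. 1194)] -/
theorem two_mul_sum_affine_mod (hp : p.Prime) {a : ℕ} (ha : ¬p ∣ a) (a₀ c : ℕ) :
    2 * ∑ i ∈ range p, (a₀ + Q * ((c + i * a) % p)) = 2 * p * a₀ + Q * (p * (p - 1)) := by
  rw [sum_add_distrib, sum_const, card_range, smul_eq_mul, ← mul_sum]
  have h : ∑ i ∈ range p, (c + i * a) % p = ∑ j ∈ range p, j := by
    rw [← sum_image (f := fun j => j) (s := range p) (g := fun i => (c + i * a) % p) ?_, image_affine_mod_eq_range hp ha c]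
    -- injectivity on `range p` (as in `image_affine_mod_eq_range`)
    intro i hi j hj hij
    have himg := image_affine_mod_eq_range hp ha c
    have hinj : ((range p).image (fun i => (c + i * a) % p)).card = (range p).card := by rw [himg]
    exact (card_image_iff.1 hinj) hi hj hij
  rw [h, ← Finset.sum_range_id_mul_two p]
  ring

/-- **Orbit sum of an entry prime to `p`**: for `p` prime, `N = pQ`, and `p ∤ ⟨h₀x⟩`,
`2·Σ_{i<p} ⟨h₀(1 + iQ)·x⟩ = 2p·(⟨h₀x⟩ mod Q) + Q·p(p − 1)` ("`= p·x₀ + Σ_{i} iN/p`"). [cite: KoblitzRohrlich1978, §3 Case 1 (p. 1194)] -/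
theorem two_mul_sum_val_orbit_mul [NeZero (p * Q)] (hp : p.Prime) (h₀ x : ZMod (p * Q)) (hpa : ¬p ∣ (h₀ * x).val) :
    2 * ∑ i ∈ range p, (h₀ * (1 + (i : ZMod (p * Q)) * (Q : ZMod (p * Q))) * x).val =
      2 * p * ((h₀ * x).val % Q) + Q * (p * (p - 1)) := by
  rw [sum_congr rfl fun i _ => val_orbit_mul_eq hp.pos h₀ x i]
  exact two_mul_sum_affine_mod hp hpa _ _

/-- **Orbit sum of an entry divisible by `p`**: `Σ_{i<p} ⟨h₀(1 + iQ)·x⟩ = p·⟨h₀x⟩` for `p ∣ x`. [cite: KoblitzRohrlich1978, §3 Case 1 (p. 1194)] -/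
theorem sum_val_orbit_mul_of_dvd [NeZero (p * Q)] (h₀ x : ZMod (p * Q)) (hx : p ∣ x.val) :
    ∑ i ∈ range p, (h₀ * (1 + (i : ZMod (p * Q)) * (Q : ZMod (p * Q))) * x).val = p * (h₀ * x).val := by
  rw [sum_congr rfl fun i _ => by rw [orbit_mul_eq_of_dvd h₀ x hx i], sum_const, card_range, smul_eq_mul]

/-- A residue is a unit iff its representative is prime to the modulus. [folklore] -/
private theorem isUnit_iff_val_coprime_bc {m : ℕ} [NeZero m] (x : ZMod m) : IsUnit x ↔ x.val.Coprime m := by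
  conv_lhs => rw [← ZMod.natCast_zmod_val x]
  exact ZMod.isUnit_iff_coprime x.val m

/-- `p ∣ ⟨x⟩ ⟹ p ∣ ⟨hx⟩` modulo `N = pQ` (for any `h`). [folklore] -/
private theorem dvd_val_mul_of_dvd [NeZero (p * Q)] (h x : ZMod (p * Q)) (hx : p ∣ x.val) : p ∣ (h * x).val := by
  rw [ZMod.val_mul]
  exact (Nat.dvd_mod_iff (dvd_mul_right p Q)).2 (dvd_mul_of_dvd_right hx _)

/-- `p ∤ ⟨x⟩`, `h` a unit ⟹ `p ∤ ⟨hx⟩` modulo `N = pQ`. [folklore] -/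
private theorem not_dvd_val_mul [NeZero (p * Q)] (hp : p.Prime) {h : ZMod (p * Q)} (hh : IsUnit h) (x : ZMod (p * Q))
    (hx : ¬p ∣ x.val) : ¬p ∣ (h * x).val := by
  intro hd
  rw [ZMod.val_mul, Nat.dvd_mod_iff (dvd_mul_right p Q)] at hd
  rcases (Nat.Prime.dvd_mul hp).1 hd with h1 | h1
  · have hc := (isUnit_iff_val_coprime_bc h).1 hh
    have := Nat.Coprime.coprime_dvd_right (dvd_mul_right p Q) hc
    exact (Nat.Prime.coprime_iff_not_dvd hp).1 this.symm h1
  · exact hx h1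

/-- For a triple of non-zero residues with `a + b + c = 0` and ANY multiplier `h`: `⟨ha⟩ + ⟨hb⟩ + ⟨hc⟩ = k·m` with `k ≤ 2`
(`= m` or `2m` for a unit `h`, possibly `0` otherwise). [cite: KoblitzRohrlich1978, §1 (p. 1184) and §3 (p. 1194)] -/
private theorem exists_val_sum_eq_mul {m : ℕ} [NeZero m] {a b c : ZMod m} (habc : a + b + c = 0) (h : ZMod m) :
    ∃ k, k ≤ 2 ∧ (h * a).val + (h * b).val + (h * c).val = k * m := by
  have hsum0 : (((h * a).val + (h * b).val + (h * c).val : ℕ) : ZMod m) = 0 := by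
    push_cast
    rw [ZMod.natCast_zmod_val, ZMod.natCast_zmod_val, ZMod.natCast_zmod_val, ← mul_add, ← mul_add, habc, mul_zero]
  obtain ⟨k, hk⟩ := (ZMod.natCast_eq_zero_iff _ _).mp hsum0
  have hxlt := ZMod.val_lt (h * a)
  have hylt := ZMod.val_lt (h * b)
  have hzlt := ZMod.val_lt (h * c)
  refine ⟨k, ?_, by rw [hk, mul_comm]⟩
  by_contra hk3
  push Not at hk3
  have := Nat.mul_le_mul_left m hk3
  omega

/-- Membership in `H_{(a,b,c)}` (unfolding the tree's `fermatCMType`). [cite: KoblitzRohrlich1978, §1 (p. 1184)] -/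
private theorem mem_fermatCMType_iff_bc {m : ℕ} [NeZero m] (a b c x : ZMod m) :
    x ∈ fermatCMType m a b c ↔ x.val.Coprime m ∧ (x * a).val + (x * b).val + (x * c).val = m := by
  simp only [fermatCMType, mem_filter, mem_univ, true_and]

/-- **The orbit of `h₀` lies in `H_τ` iff `h₀` does** (for `p ∣ r, s, t`): a UNIT `h₀(1 + iQ)` is in `H_{(r,s,t)}` iff `h₀` is
("`P* ⊂ H_τ`"). [cite: KoblitzRohrlich1978, §3 Case 1 (p. 1193)] -/
theorem orbit_mem_fermatCMType_iff [NeZero (p * Q)] {r s t : ZMod (p * Q)} (hr : p ∣ r.val) (hs : p ∣ s.val) (ht : p ∣ t.val)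
    {h₀ : ZMod (p * Q)} (hh₀ : IsUnit h₀) {i : ℕ} (hu : IsUnit (h₀ * (1 + (i : ZMod (p * Q)) * (Q : ZMod (p * Q))))) :
    h₀ * (1 + (i : ZMod (p * Q)) * (Q : ZMod (p * Q))) ∈ fermatCMType (p * Q) r s t ↔ h₀ ∈ fermatCMType (p * Q) r s t := by
  rw [mem_fermatCMType_iff_bc, mem_fermatCMType_iff_bc, orbit_mul_eq_of_dvd h₀ r hr, orbit_mul_eq_of_dvd h₀ s hs,
    orbit_mul_eq_of_dvd h₀ t ht, and_iff_right ((isUnit_iff_val_coprime_bc _).1 hu),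
    and_iff_right ((isUnit_iff_val_coprime_bc _).1 hh₀)]

/-- A non-unit orbit point `h₀(1 + iQ)` (`h₀` a unit) has `p ∣ 1 + iQ`. [cite: KoblitzRohrlich1978, §3 Case 1 (p. 1193: "`ν = #(P∖P*)`")] -/
theorem dvd_of_not_isUnit_orbit [NeZero (p * Q)] (hp : p.Prime) {h₀ : ZMod (p * Q)} (hh₀ : IsUnit h₀) {i : ℕ}
    (hu : ¬IsUnit (h₀ * (1 + (i : ZMod (p * Q)) * (Q : ZMod (p * Q))))) : p ∣ 1 + i * Q := by
  by_contra hnd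
  apply hu
  refine hh₀.mul ?_
  have e : (1 + (i : ZMod (p * Q)) * (Q : ZMod (p * Q))) = ((1 + i * Q : ℕ) : ZMod (p * Q)) := by push_cast; ring
  rw [e, ZMod.isUnit_iff_coprime]
  exact Nat.Coprime.mul_right ((Nat.Prime.coprime_iff_not_dvd hp).2 hnd).symm
    ((Nat.coprime_add_mul_right_left 1 Q i).2 (Nat.coprime_one_left Q))

/-- **`ν ≤ 1`**: at most one orbit point `h₀(1 + iQ)`, `i < p`, is a non-unit (`ν = 0` if `p² ∣ N`, `ν = 1` if `p² ∤ N`).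
[cite: KoblitzRohrlich1978, §3 Case 1 (p. 1193)] -/
theorem card_filter_not_isUnit_orbit_le_one [NeZero (p * Q)] (hp : p.Prime) {h₀ : ZMod (p * Q)} (hh₀ : IsUnit h₀) :
    ((range p).filter fun i : ℕ => ¬IsUnit (h₀ * (1 + (i : ZMod (p * Q)) * (Q : ZMod (p * Q))))).card ≤ 1 := by
  refine card_le_one.2 fun i hi j hj => ?_
  rw [mem_filter, mem_range] at hi hj
  have hi' := dvd_of_not_isUnit_orbit hp hh₀ hi.2
  have hj' := dvd_of_not_isUnit_orbit hp hh₀ hj.2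
  have hpQ : ¬p ∣ Q := by
    intro h
    have h1 : p ∣ 1 := (Nat.dvd_add_left (dvd_mul_of_dvd_right h i)).1 hi'
    exact hp.one_lt.ne' (Nat.dvd_one.1 h1)
  have h1 : 1 + i * Q ≡ 1 + j * Q [MOD p] :=
    (Nat.modEq_zero_iff_dvd.2 hi').trans (Nat.modEq_zero_iff_dvd.2 hj').symm
  have h2 : i * Q ≡ j * Q [MOD p] := Nat.ModEq.add_left_cancel' 1 h1
  have h3 : i ≡ j [MOD p] := Nat.ModEq.cancel_right_of_coprime ((Nat.Prime.coprime_iff_not_dvd hp).2 hpQ) h2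
  exact Nat.ModEq.eq_of_lt_of_lt h3 hi.1 hj.1

/-- A non-unit orbit point kills every entry whose `h₀`-multiple is divisible by `Q`: `p ∣ 1 + iQ`, `Q ∣ ⟨h₀x⟩ ⟹ ⟨h₀(1 + iQ)x⟩ = 0`.
[cite: KoblitzRohrlich1978, §3 Case 1 (p. 1194)] -/
theorem val_orbit_mul_eq_zero [NeZero (p * Q)] (h₀ x : ZMod (p * Q)) {i : ℕ} (hi : p ∣ 1 + i * Q) (hQ : Q ∣ (h₀ * x).val) :
    (h₀ * (1 + (i : ZMod (p * Q)) * (Q : ZMod (p * Q))) * x).val = 0 := by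
  obtain ⟨m, hm⟩ := hi
  obtain ⟨m', hm'⟩ := hQ
  have e : h₀ * (1 + (i : ZMod (p * Q)) * (Q : ZMod (p * Q))) * x =
      ((1 + i * Q : ℕ) : ZMod (p * Q)) * (((h₀ * x).val : ℕ) : ZMod (p * Q)) := by
    rw [ZMod.natCast_zmod_val]; push_cast; ring
  rw [e, ← Nat.cast_mul, hm, hm', ZMod.val_eq_zero, ZMod.natCast_eq_zero_iff]
  exact ⟨m * m', by ring⟩

/-- `H_τ` is non-empty: `1 ∈ H_τ` or `−1 ∈ H_τ`. [cite: KoblitzRohrlich1978, §1 (p. 1183: "a set of coset representatives for `{−1, 1}`")] -/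
private theorem exists_mem_fermatCMType_bc {m : ℕ} [NeZero m] {a b c : ZMod m} (ha : a ≠ 0) (hb : b ≠ 0) (hc : c ≠ 0)
    (habc : a + b + c = 0) : ∃ h₀, h₀ ∈ fermatCMType m a b c := by
  have hcm := (CyclotomicCMType.isCMTypeSet_fermatCMType ha hb hc habc).2 1 ((isUnit_iff_val_coprime_bc 1).1 isUnit_one)
  by_cases h1 : (1 : ZMod m) ∈ fermatCMType m a b c
  · exact ⟨1, h1⟩
  · exact ⟨-1, by_contra fun hn => h1 (hcm.2 hn)⟩

end Orbit

/-! ## §2 CASE 1, first sub-case: `p ∣ r, s, t`, `p ∤ r′s′t′` ⟹ `H_τ ≠ H_{τ′}` -/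

section SubcaseA

variable {p Q : ℕ} [NeZero (p * Q)]

/-- **§3 PROPOSITION, CASE 1, "First suppose `p ∤ r′, s′, t′`"** (every `N = pQ`, `p ≥ 5` prime; `N` prime to `6` is not needed here).
If `p` divides `r, s, t` (representatives) and divides none of `r′, s′, t′`, then `H_{(r,s,t)} ≠ H_{(r′,s′,t′)}`.  PROOF (the printed one,
around an arbitrary `h₀ ∈ H_τ` instead of K–R's normalisation `1 ∈ H_τ`): the units of the orbit `h₀P`, `P = 1 + Q·ℤ/p`, lie in
`H_τ = H_{τ′}` so contribute `N` each to `Σ_{u ∈ h₀P} ⟨ur′⟩ + ⟨us′⟩ + ⟨ut′⟩`, the `ν ≤ 1` non-units at most `2N`; but the orbit sum is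
`p·X₀ + 3N(p−1)/2` ("`≥ N + 3(p−1)N/2` … This contradicts (3) because `(p − 1)/2 ≥ 2 > ν`"): `3(p−1) ≤ 2(p+ν)` forces `p = 5`, `ν = 1`,
`X₀ = 0`, and then the non-unit point contributes `0`, not `2N`. [cite: KoblitzRohrlich1978, §3 Proposition, Case 1 (pp. 1193–1194)] -/
theorem fermatCMType_ne_of_dvd_of_not_dvd (hp : p.Prime) (hp5 : 5 ≤ p)
    {r s t r' s' t' : ZMod (p * Q)} (hr : r ≠ 0) (hs : s ≠ 0) (ht : t ≠ 0) (hrst : r + s + t = 0)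
    (hrst' : r' + s' + t' = 0) (hpr : p ∣ r.val) (hps : p ∣ s.val) (hpt : p ∣ t.val)
    (hpr' : ¬p ∣ r'.val) (hps' : ¬p ∣ s'.val) (hpt' : ¬p ∣ t'.val) :
    fermatCMType (p * Q) r s t ≠ fermatCMType (p * Q) r' s' t' := by
  intro hEq
  have hQ : 0 < Q := Nat.pos_of_ne_zero fun h => NeZero.ne (p * Q) (by rw [h, mul_zero])
  have hN : 0 < p * Q := Nat.mul_pos hp.pos hQ
  obtain ⟨h₀, hh₀H⟩ := exists_mem_fermatCMType_bc hr hs ht hrst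
  have hh₀u : IsUnit h₀ := (isUnit_iff_val_coprime_bc h₀).2 ((mem_fermatCMType_iff_bc _ _ _ _).1 hh₀H).1
  -- the orbit `O i = h₀(1 + iQ)` and `S′(i) = ⟨O i·r′⟩ + ⟨O i·s′⟩ + ⟨O i·t′⟩`
  set O : ℕ → ZMod (p * Q) := fun i => h₀ * (1 + (i : ZMod (p * Q)) * (Q : ZMod (p * Q))) with hO
  set S' : ℕ → ℕ := fun i => (O i * r').val + (O i * s').val + (O i * t').val with hS'
  have hunit : ∀ i, IsUnit (O i) → S' i = p * Q := fun i hu => by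
    have hmem : O i ∈ fermatCMType (p * Q) r' s' t' := hEq ▸ (orbit_mem_fermatCMType_iff hpr hps hpt hh₀u hu).2 hh₀H
    exact ((mem_fermatCMType_iff_bc _ _ _ _).1 hmem).2
  have hle : ∀ i, S' i ≤ 2 * (p * Q) := fun i => by
    obtain ⟨k, hk, e⟩ := exists_val_sum_eq_mul hrst' (O i)
    change (O i * r').val + (O i * s').val + (O i * t').val ≤ _
    rw [e]
    exact Nat.mul_le_mul_right _ hk
  -- the non-units of the orbit
  set C := (range p).filter fun i : ℕ => ¬IsUnit (O i) with hC
  have hCle : C.card ≤ 1 := card_filter_not_isUnit_orbit_le_one hp hh₀u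
  have hsplit : ∑ i ∈ range p, S' i = (p - C.card) * (p * Q) + ∑ i ∈ C, S' i := by
    rw [← sum_filter_add_sum_filter_not (range p) (fun i => IsUnit (O i))]
    congr 1
    rw [sum_const_nat (fun i hi => hunit i (mem_filter.1 hi).2)]
    congr 1
    have hUC : ((range p).filter fun i => IsUnit (O i)).card + C.card = p := by
      have := Finset.card_filter_add_card_filter_not (s := range p) (fun i => IsUnit (O i))
      simpa [hC] using this
    omega
  have hCsum : ∑ i ∈ C, S' i ≤ C.card * (2 * (p * Q)) := by
    have := sum_le_card_nsmul C S' (2 * (p * Q)) (fun i _ => hle i)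
    simpa using this
  -- the orbit sum
  have h2sum : 2 * ∑ i ∈ range p, S' i =
      2 * p * ((h₀ * r').val % Q + (h₀ * s').val % Q + (h₀ * t').val % Q) + 3 * (Q * (p * (p - 1))) := by
    change 2 * ∑ i ∈ range p, ((O i * r').val + (O i * s').val + (O i * t').val) = _
    rw [sum_add_distrib, sum_add_distrib, mul_add, mul_add, two_mul_sum_val_orbit_mul hp h₀ r' (not_dvd_val_mul hp hh₀u r' hpr'),
      two_mul_sum_val_orbit_mul hp h₀ s' (not_dvd_val_mul hp hh₀u s' hps'),
      two_mul_sum_val_orbit_mul hp h₀ t' (not_dvd_val_mul hp hh₀u t' hpt')]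
    ring
  set X₀ := (h₀ * r').val % Q + (h₀ * s').val % Q + (h₀ * t').val % Q with hX₀
  -- Step 1: `3(p − 1) ≤ 2(p + ν) ≤ 2(p + 1)`, so `p = 5`
  have key : (p * Q) * (3 * (p - 1)) ≤ (p * Q) * (2 * (p - C.card) + 4 * C.card) :=
    calc (p * Q) * (3 * (p - 1)) = 3 * (Q * (p * (p - 1))) := by ring
      _ ≤ 2 * p * X₀ + 3 * (Q * (p * (p - 1))) := le_add_self
      _ = 2 * ((p - C.card) * (p * Q)) + 2 * ∑ i ∈ C, S' i := by rw [← h2sum, hsplit, mul_add]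
      _ ≤ 2 * ((p - C.card) * (p * Q)) + 2 * (C.card * (2 * (p * Q))) := by linarith [hCsum]
      _ = (p * Q) * (2 * (p - C.card) + 4 * C.card) := by ring
  have key' := Nat.le_of_mul_le_mul_left key hN
  have hp5' : p = 5 := by omega
  subst hp5'
  -- Step 2 (`p = 5`): `ν = 1`, `X₀ = 0`, and the non-unit point contributes `2N`
  have hid : 10 * X₀ + 60 * Q = 2 * ((5 - C.card) * (5 * Q)) + 2 * ∑ i ∈ C, S' i := by
    have e : 3 * (Q * (5 * (5 - 1))) = 60 * Q := by ring
    rw [← e, ← h2sum, hsplit, mul_add]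
  rcases Nat.le_one_iff_eq_zero_or_eq_one.1 hCle with hc | hc
  · -- `ν = 0`: `60Q = 50Q`
    have hCe : C = ∅ := card_eq_zero.1 hc
    rw [hc, hCe, sum_empty] at hid
    omega
  · obtain ⟨i₀, hCi⟩ := card_eq_one.1 hc
    rw [hc, hCi, sum_singleton] at hid
    have hSi := hle i₀
    have hX : X₀ = 0 := by omega
    have hS0 : S' i₀ = 10 * Q := by omega
    -- but `X₀ = 0` means `Q ∣ ⟨h₀r′⟩, ⟨h₀s′⟩, ⟨h₀t′⟩`, and `i₀ ∈ C` means `5 ∣ 1 + i₀Q`: so `S′(i₀) = 0`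
    have hi₀ : i₀ ∈ C := by rw [hCi]; exact mem_singleton_self _
    have hdiv := dvd_of_not_isUnit_orbit hp hh₀u (mem_filter.1 hi₀).2
    have hr0 : Q ∣ (h₀ * r').val := Nat.dvd_of_mod_eq_zero (by omega)
    have hs0 : Q ∣ (h₀ * s').val := Nat.dvd_of_mod_eq_zero (by omega)
    have ht0 : Q ∣ (h₀ * t').val := Nat.dvd_of_mod_eq_zero (by omega)
    have hS00 : S' i₀ = 0 := by
      change (O i₀ * r').val + (O i₀ * s').val + (O i₀ * t').val = 0
      rw [val_orbit_mul_eq_zero h₀ r' hdiv hr0, val_orbit_mul_eq_zero h₀ s' hdiv hs0, val_orbit_mul_eq_zero h₀ t' hdiv ht0]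
    omega

end SubcaseA

/-! ## §3 The multiplier `u₀` with `2N/5 ≤ ⟨u₀x⟩ ≤ 3N/5` (`N` prime to `6`): K–R's `2^β, 3·2^{β−1}, 3·2^{β−2}` -/

section Middle

/-- **The {2,3}-smooth number in `[2y/5, 3y/5]`**: for `y ≥ 5` one of `2^β, 3·2^{β−1}, 3·2^{β−2}` (`β = ⌊log₂(y/√2)⌋`) lies in
`[2y/5, 3y/5]` ("Let … `β = [log₂ y/√2]`.  Then `y/2√2 < 2^β ≤ y/√2` … If `2^β < 2y/5`, then `3·2^{β−1}` is `< 3y/5` and `> (3/2)(y/2√2) > 2y/5`.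
If `2^β > 3y/5` … then `3·2^{β−2}` is `> (3/4)(3y/5) > 2y/5` and `< (3/4)(y/√2) < 3y/5`"); integer version with `2·4^β ≤ y² < 8·4^β`.
[cite: KoblitzRohrlich1978, §3 Case 1 (pp. 1194–1195)] -/
theorem exists_smooth_mem_middle {y : ℕ} (hy : 5 ≤ y) :
    ∃ u i j : ℕ, u = 2 ^ i * 3 ^ j ∧ 2 * y ≤ 5 * u ∧ 5 * u ≤ 3 * y := by
  -- `B = 2^β` with `2B² ≤ y² < 8B²`
  set β := Nat.log 4 (y ^ 2 / 2) with hβ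
  have hy2 : y ^ 2 / 2 ≠ 0 := by
    have : 25 ≤ y ^ 2 := by nlinarith
    omega
  have hlow : 4 ^ β ≤ y ^ 2 / 2 := Nat.pow_log_le_self 4 hy2
  have hupp : y ^ 2 / 2 < 4 ^ (β + 1) := Nat.lt_pow_succ_log_self (by norm_num) _
  set B := 2 ^ β with hB
  have hB4 : 4 ^ β = B * B := by rw [hB, ← pow_two, ← pow_mul, mul_comm, pow_mul]; norm_num
  have hyy : y * y = y ^ 2 := by ring
  have h4 : 4 ^ (β + 1) = 4 * 4 ^ β := pow_succ' 4 β
  have h1' : 2 * 4 ^ β ≤ y ^ 2 := by omega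
  have h2' : y ^ 2 < 8 * 4 ^ β := by omega
  have h1 : 2 * (B * B) ≤ y * y := by rw [← hB4, hyy]; exact h1'
  have h2 : y * y < 8 * (B * B) := by rw [← hB4, hyy]; exact h2'
  by_cases hlt : 5 * B < 2 * y
  · -- `u = 3·2^{β−1}`
    have hβ1 : 1 ≤ β := by
      by_contra h0
      have : β = 0 := by omega
      rw [hB, this, pow_zero] at h2
      nlinarith
    obtain ⟨β', hβ'⟩ : ∃ β', β = β' + 1 := ⟨β - 1, by omega⟩
    have hBB : B = 2 * 2 ^ β' := by rw [hB, hβ', pow_succ, mul_comm]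
    refine ⟨3 * 2 ^ β', β', 1, by ring, ?_, ?_⟩
    · -- `4y ≤ 15B`: else `16y² ≥ (15B)² > 128B²`
      by_contra hc
      push Not at hc
      rw [hBB] at h2
      nlinarith
    · rw [hBB] at hlt
      omega
  by_cases hgt : 3 * y < 5 * B
  · -- `u = 3·2^{β−2}`
    have hβ2 : 2 ≤ β := by
      by_contra h0
      have hb : β = 0 ∨ β = 1 := by omega
      rcases hb with hb | hb
      · rw [hB, hb] at hgt; norm_num at hgt; omega
      · rw [hB, hb] at hgt; norm_num at hgt; omega
    obtain ⟨β', hβ'⟩ : ∃ β', β = β' + 2 := ⟨β - 2, by omega⟩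
    have hBB : B = 4 * 2 ^ β' := by rw [hB, hβ', pow_add]; norm_num; ring
    refine ⟨3 * 2 ^ β', β', 1, by ring, ?_, ?_⟩
    · rw [hBB] at hgt
      omega
    · -- `5B ≤ 4y`: else `25B² > 16y² ≥ 32B²/... `
      by_contra hc
      push Not at hc
      rw [hBB] at h1
      nlinarith
  · exact ⟨B, β, 0, by rw [hB, pow_zero, mul_one], by omega, by omega⟩

/-- A {2,3}-smooth number is prime to an `M` prime to `6`. [folklore] -/
private theorem coprime_smooth_of_coprime_six {M : ℕ} (hM2 : Nat.Coprime 2 M) (hM3 : Nat.Coprime 3 M) (i j : ℕ) :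
    Nat.Coprime (2 ^ i * 3 ^ j) M :=
  Nat.Coprime.mul_left (Nat.Coprime.pow_left i hM2) (Nat.Coprime.pow_left j hM3)

variable {N : ℕ} [NeZero N]

/-- **The multiplier `u₀`**: for `N` prime to `6` and any non-zero residue `x` there is a UNIT `u` modulo `N` with
`2N ≤ 5⟨ux⟩ ≤ 3N` ("It clearly suffices if `2N/5 ≤ r′ ≤ 3N/5`. Let `x = g.c.d.(r′, N)`, `y = N/x` … Now let `u₁ ∈ (ℤ/Nℤ)*` equal either
`2^β, 3·2^{β−1}`, or `3·2^{β−2}`, so that `2y/5 ≤ u₁ ≤ 3y/5`. Then if `(r′/x)ũ₀ = u₁` … we have `2N/5 ≤ ⟨u₀r′⟩ ≤ 3N/5`, as required").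
[cite: KoblitzRohrlich1978, §3 Case 1 (pp. 1194–1195)] -/
theorem exists_isUnit_val_mul_mem_middle (hN2 : Nat.Coprime 2 N) (hN3 : Nat.Coprime 3 N) {x : ZMod N} (hx : x ≠ 0) :
    ∃ u : ZMod N, IsUnit u ∧ 2 * N ≤ 5 * (u * x).val ∧ 5 * (u * x).val ≤ 3 * N := by
  have hN0 : 0 < N := Nat.pos_of_ne_zero (NeZero.ne N)
  set a := x.val with ha
  have ha0 : 0 < a := Nat.pos_of_ne_zero fun h => hx ((ZMod.val_eq_zero x).1 h)
  have haN : a < N := ZMod.val_lt x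
  set g := Nat.gcd a N with hg
  have hg0 : 0 < g := Nat.gcd_pos_of_pos_left N ha0
  obtain ⟨y, hyN⟩ : g ∣ N := Nat.gcd_dvd_right a N
  obtain ⟨a₁, ha₁⟩ : g ∣ a := Nat.gcd_dvd_left a N
  have hy0 : 0 < y := Nat.pos_of_ne_zero fun h => by rw [h, mul_zero] at hyN; omega
  have hcop : Nat.Coprime a₁ y := by
    have h := Nat.coprime_div_gcd_div_gcd (m := a) (n := N) hg0
    rw [← hg] at h
    have e1 : a / g = a₁ := by rw [ha₁, Nat.mul_div_cancel_left _ hg0]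
    have e2 : N / g = y := by rw [hyN, Nat.mul_div_cancel_left _ hg0]
    rwa [e1, e2] at h
  -- `y ≥ 5`: `y > 1` (as `a < N`) and `y` is prime to `6`
  have hy1 : y ≠ 1 := by
    intro h1; rw [h1, mul_one] at hyN
    have : g ≤ a := Nat.le_of_dvd ha0 (Nat.gcd_dvd_left a N)
    omega
  have hy2 : Nat.Coprime 2 y := Nat.Coprime.coprime_dvd_right ⟨g, by rw [hyN, mul_comm]⟩ hN2
  have hy3 : Nat.Coprime 3 y := Nat.Coprime.coprime_dvd_right ⟨g, by rw [hyN, mul_comm]⟩ hN3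
  have hy5 : 5 ≤ y := by
    have h2 : ¬2 ∣ y := fun h => by have := Nat.Coprime.eq_one_of_dvd hy2 h; omega
    have h3 : ¬3 ∣ y := fun h => by have := Nat.Coprime.eq_one_of_dvd hy3 h; omega
    omega
  obtain ⟨u₁, i, j, hu₁, hlo, hhi⟩ := exists_smooth_mem_middle hy5
  have hu₁N : Nat.Coprime u₁ N := hu₁ ▸ coprime_smooth_of_coprime_six hN2 hN3 i j
  have hu₁y : Nat.Coprime u₁ y := Nat.Coprime.coprime_dvd_right ⟨g, by rw [hyN, mul_comm]⟩ hu₁N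
  -- the unit `v = u₁·a₁⁻¹` modulo `y`, lifted to a unit `U` modulo `N`
  haveI : NeZero y := ⟨hy0.ne'⟩
  let v : (ZMod y)ˣ := ZMod.unitOfCoprime u₁ hu₁y * (ZMod.unitOfCoprime a₁ hcop)⁻¹
  have hyd : y ∣ N := ⟨g, by rw [hyN, mul_comm]⟩
  obtain ⟨U, hU⟩ := ZMod.unitsMap_surjective hyd v
  have hUv : ZMod.castHom hyd (ZMod y) (U : ZMod N) = (v : ZMod y) := by
    rw [← hU]; rfl
  have hva : (v : ZMod y) * (a₁ : ZMod y) = (u₁ : ZMod y) := by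
    change ((ZMod.unitOfCoprime u₁ hu₁y * (ZMod.unitOfCoprime a₁ hcop)⁻¹ : (ZMod y)ˣ) : ZMod y) * (a₁ : ZMod y) = _
    rw [Units.val_mul, mul_assoc, ← ZMod.coe_unitOfCoprime a₁ hcop, Units.inv_mul, mul_one, ZMod.coe_unitOfCoprime]
  -- `U·a ≡ g·u₁ (mod N)`
  have hmod : (U : ZMod N).val * a₁ ≡ u₁ [MOD y] := by
    rw [← ZMod.natCast_eq_natCast_iff, Nat.cast_mul, ← hva, ← hUv, ZMod.castHom_apply, ZMod.cast_eq_val]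
  have hUx : (U : ZMod N) * x = ((g * u₁ : ℕ) : ZMod N) := by
    have e : (U : ZMod N) * x = (((U : ZMod N).val * a : ℕ) : ZMod N) := by
      rw [Nat.cast_mul, ZMod.natCast_zmod_val, ha, ZMod.natCast_zmod_val]
    rw [e, ZMod.natCast_eq_natCast_iff, ha₁]
    have := Nat.ModEq.mul_left' g hmod
    rw [← mul_assoc, mul_comm g ((U : ZMod N).val), mul_assoc, ← hyN] at this
    exact this
  have hval : ((U : ZMod N) * x).val = g * u₁ := by
    rw [hUx, ZMod.val_natCast, Nat.mod_eq_of_lt]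
    rw [hyN]
    exact (Nat.mul_lt_mul_left hg0).2 (by omega)
  refine ⟨U, U.isUnit, ?_, ?_⟩
  · rw [hval, hyN]; nlinarith
  · rw [hval, hyN]; nlinarith

end Middle

/-! ## §4 CASE 1, second sub-case: `p ∣ r, s, t`, `p ∣ r′`, `p ∤ s′t′` ⟹ `H_τ ≠ H_{τ′}` (`N` prime to `6`) -/

section SubcaseB

variable {p Q : ℕ} [NeZero (p * Q)]

/-- `(p − 1)·N + N = p·N` in `ℕ` (bookkeeping for truncated subtraction). [folklore] -/
private theorem pred_mul_add_bc (hp : 0 < p) (N : ℕ) : N * (p - 1) + N = p * N := by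
  obtain ⟨p', rfl⟩ : ∃ p', p = p' + 1 := ⟨p - 1, by omega⟩
  rw [Nat.add_sub_cancel]; ring

/-- **§3 PROPOSITION, CASE 1, "Now suppose, say, `p ∣ r′`"** (`N = pQ` prime to `6`, `p ≥ 5`).  If `p` divides `r, s, t` and `r′` but
neither `s′` nor `t′`, then `H_{(r,s,t)} ≠ H_{(r′,s′,t′)}`.  PROOF (the printed one): choose the unit `u₀` of §3 with
`2N/5 ≤ ⟨u₀r′⟩ ≤ 3N/5` and sum `⟨ur′⟩ + ⟨us′⟩ + ⟨ut′⟩` over the orbit `u ∈ u₀P`: the sum is `p⟨u₀r′⟩ + p(s₀′ + t₀′) + (p − 1)N` with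
`0 < s₀′ + t₀′ < 2N/p`, hence strictly between `(p + ν)N` and `(2p − ν)N`; but it is `≤ (p + ν)N` if `u₀ ∈ H_τ` ("(3)") and `≥ (2p − ν)N` if
`u₀ ∉ H_τ` ("(4)"). [cite: KoblitzRohrlich1978, §3 Proposition, Case 1 (pp. 1194–1195)] -/
theorem fermatCMType_ne_of_dvd_of_dvd_of_not_dvd (hp : p.Prime) (hp5 : 5 ≤ p)
    (hN2 : Nat.Coprime 2 (p * Q)) (hN3 : Nat.Coprime 3 (p * Q))
    {r s t r' s' t' : ZMod (p * Q)} (hrst' : r' + s' + t' = 0) (hr' : r' ≠ 0)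
    (hpr : p ∣ r.val) (hps : p ∣ s.val) (hpt : p ∣ t.val)
    (hpr' : p ∣ r'.val) (hps' : ¬p ∣ s'.val) (hpt' : ¬p ∣ t'.val) :
    fermatCMType (p * Q) r s t ≠ fermatCMType (p * Q) r' s' t' := by
  intro hEq
  have hQ : 0 < Q := Nat.pos_of_ne_zero fun h => NeZero.ne (p * Q) (by rw [h, mul_zero])
  have hN : 0 < p * Q := Nat.mul_pos hp.pos hQ
  -- K–R's `u₀`
  obtain ⟨h₀, hh₀u, hlo, hhi⟩ := exists_isUnit_val_mul_mem_middle hN2 hN3 hr'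
  set a := (h₀ * r').val with ha
  set O : ℕ → ZMod (p * Q) := fun i => h₀ * (1 + (i : ZMod (p * Q)) * (Q : ZMod (p * Q))) with hO
  set S' : ℕ → ℕ := fun i => (O i * r').val + (O i * s').val + (O i * t').val with hS'
  -- first coordinate is constant along the orbit
  have hOr : ∀ i, (O i * r').val = a := fun i => by rw [ha, ← orbit_mul_eq_of_dvd h₀ r' hpr' i]
  -- `2Q ≤ a ≤ (p − 2)Q`, in the forms `2N ≤ p·a` and `p·a + 2N ≤ p·N`
  have e1 : p * (2 * (p * Q)) ≤ p * (5 * a) := Nat.mul_le_mul_left p hlo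
  have e2 : 2 * (p * Q) * 5 ≤ 2 * (p * Q) * p := Nat.mul_le_mul_left _ hp5
  have e3 : p * (5 * a) ≤ p * (3 * (p * Q)) := Nat.mul_le_mul_left p hhi
  have hpa_lo : 2 * (p * Q) ≤ p * a := by nlinarith
  have hpa_hi : p * a + 2 * (p * Q) ≤ p * (p * Q) := by nlinarith
  have ha0 : 0 < a := by nlinarith
  -- `Y₀ = s₀′ + t₀′`, with `1 ≤ Y₀` and `p·Y₀ + 2p ≤ 2N`
  set Y₀ := (h₀ * s').val % Q + (h₀ * t').val % Q with hY₀
  have hY_hi : p * Y₀ + 2 * p ≤ 2 * (p * Q) := by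
    have h1 := Nat.mod_lt (h₀ * s').val hQ
    have h2 := Nat.mod_lt (h₀ * t').val hQ
    have : Y₀ + 2 ≤ 2 * Q := by omega
    nlinarith
  have hY_lo : 1 ≤ Y₀ := by
    by_contra hY
    have hb : Q ∣ (h₀ * s').val := Nat.dvd_of_mod_eq_zero (by omega)
    have hc : Q ∣ (h₀ * t').val := Nat.dvd_of_mod_eq_zero (by omega)
    by_cases hpQ : p ∣ Q
    · exact not_dvd_val_mul hp hh₀u s' hps' (dvd_trans hpQ hb)
    · -- `Q ∣ a` and `p ∣ a`, so `N ∣ a`, `a = 0`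
      obtain ⟨k, -, hk⟩ := exists_val_sum_eq_mul hrst' h₀
      have hQa : Q ∣ a := by
        have h1 : Q ∣ a + ((h₀ * s').val + (h₀ * t').val) := by
          rw [← add_assoc, ha, hk]; exact ⟨k * p, by ring⟩
        exact (Nat.dvd_add_left (dvd_add hb hc)).1 h1
      have hpa : p ∣ a := dvd_val_mul_of_dvd h₀ r' hpr'
      have hNa : p * Q ∣ a := Nat.Coprime.mul_dvd_of_dvd_of_dvd ((Nat.Prime.coprime_iff_not_dvd hp).2 hpQ) hpa hQa
      have : a < p * Q := ZMod.val_lt _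
      have := Nat.le_of_dvd ha0 hNa
      omega
  -- the orbit sum `2T = 2pa + 2pY₀ + 2(p−1)N`
  have h2sum : 2 * ∑ i ∈ range p, S' i = 2 * (p * a) + 2 * (p * Y₀) + 2 * ((p * Q) * (p - 1)) := by
    change 2 * ∑ i ∈ range p, ((O i * r').val + (O i * s').val + (O i * t').val) = _
    rw [sum_add_distrib, sum_add_distrib, mul_add, mul_add, sum_val_orbit_mul_of_dvd h₀ r' hpr',
      two_mul_sum_val_orbit_mul hp h₀ s' (not_dvd_val_mul hp hh₀u s' hps'),
      two_mul_sum_val_orbit_mul hp h₀ t' (not_dvd_val_mul hp hh₀u t' hpt')]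
    ring
  have hD : (p * Q) * (p - 1) + p * Q = p * (p * Q) := pred_mul_add_bc hp.pos _
  -- units and non-units of the orbit
  set C := (range p).filter fun i : ℕ => ¬IsUnit (O i) with hC
  have hCle : C.card ≤ 1 := card_filter_not_isUnit_orbit_le_one hp hh₀u
  have hUC : ((range p).filter fun i => IsUnit (O i)).card + C.card = p := by
    have := Finset.card_filter_add_card_filter_not (s := range p) (fun i => IsUnit (O i))
    simpa [hC] using this
  have hsplit : ∑ i ∈ range p, S' i = ∑ i ∈ (range p).filter (fun i => IsUnit (O i)), S' i + ∑ i ∈ C, S' i :=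
    (sum_filter_add_sum_filter_not (range p) (fun i => IsUnit (O i)) _).symm
  -- every orbit value is `kN`, `k ≤ 2`, and positive
  have hkN : ∀ i, ∃ k, k ≤ 2 ∧ S' i = k * (p * Q) := fun i => exists_val_sum_eq_mul hrst' (O i)
  have hpos : ∀ i, 0 < S' i := fun i => by
    change 0 < (O i * r').val + (O i * s').val + (O i * t').val
    rw [hOr i]; omega
  by_cases hh₀H : h₀ ∈ fermatCMType (p * Q) r s t
  · -- "(3)": units of the orbit lie in `H_τ = H_{τ′}`, so contribute `N` each
    have hunit : ∀ i ∈ (range p).filter (fun i => IsUnit (O i)), S' i = p * Q := fun i hi => by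
      have hu := (mem_filter.1 hi).2
      have hmem : O i ∈ fermatCMType (p * Q) r' s' t' := hEq ▸ (orbit_mem_fermatCMType_iff hpr hps hpt hh₀u hu).2 hh₀H
      exact ((mem_fermatCMType_iff_bc _ _ _ _).1 hmem).2
    rw [sum_const_nat hunit] at hsplit
    have hpY : p ≤ p * Y₀ := Nat.le_mul_of_pos_right p hY_lo
    rcases Nat.le_one_iff_eq_zero_or_eq_one.1 hCle with hc | hc
    · have hU : ((range p).filter fun i => IsUnit (O i)).card = p := by omega
      rw [card_eq_zero.1 hc, sum_empty, hU] at hsplit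
      omega
    · obtain ⟨i₀, hCi⟩ := card_eq_one.1 hc
      have hU : ((range p).filter fun i => IsUnit (O i)).card = p - 1 := by omega
      rw [hCi, sum_singleton, hU, mul_comm (p - 1) (p * Q)] at hsplit
      obtain ⟨k, hk, hki⟩ := hkN i₀
      interval_cases k <;> omega
  · -- "(4)": units of the orbit lie outside `H_{τ′}`, so contribute `2N` each
    have hunit : ∀ i ∈ (range p).filter (fun i => IsUnit (O i)), S' i = 2 * (p * Q) := fun i hi => by
      have hu := (mem_filter.1 hi).2
      have hnmem : O i ∉ fermatCMType (p * Q) r' s' t' := fun hmem =>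
        hh₀H ((orbit_mem_fermatCMType_iff hpr hps hpt hh₀u hu).1 (hEq ▸ hmem))
      rw [mem_fermatCMType_iff_bc, not_and, ← isUnit_iff_val_coprime_bc] at hnmem
      have hne : S' i ≠ p * Q := hnmem hu
      obtain ⟨k, hk, hki⟩ := hkN i
      have h0 := hpos i
      interval_cases k <;> omega
    rw [sum_const_nat hunit] at hsplit
    have hpY : p ≤ p * Y₀ := Nat.le_mul_of_pos_right p hY_lo
    rcases Nat.le_one_iff_eq_zero_or_eq_one.1 hCle with hc | hc
    · have hU : ((range p).filter fun i => IsUnit (O i)).card = p := by omega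
      have e : p * (2 * (p * Q)) = 2 * (p * (p * Q)) := by ring
      rw [card_eq_zero.1 hc, sum_empty, hU, e] at hsplit
      omega
    · obtain ⟨i₀, hCi⟩ := card_eq_one.1 hc
      have hU : ((range p).filter fun i => IsUnit (O i)).card = p - 1 := by omega
      have e : (p - 1) * (2 * (p * Q)) = 2 * (p * Q * (p - 1)) := by ring
      rw [hCi, sum_singleton, hU, e] at hsplit
      obtain ⟨k, hk, hki⟩ := hkN i₀
      have h0 := hpos i₀
      interval_cases k <;> omega

end SubcaseB

/-! ## §5 CASE 1 assembled: `H_τ = H_{τ′}`, `p ∣ τ` ⟹ `p ∣ τ′`; the primes of the level are an invariant of `H`; on abelian varieties -/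

section CaseOne

variable {p Q : ℕ} [NeZero (p * Q)]

/-- `H_{(a,b,c)} = H_{(b,a,c)}`. [cite: KoblitzRohrlich1978, §1 (p. 1184: "`H_{r,s,t}` depends on `{r, s, t}` only up to permutation")] -/
private theorem fermatCMType_swap₁₂ {m : ℕ} [NeZero m] (a b c : ZMod m) : fermatCMType m a b c = fermatCMType m b a c := by
  ext x; simp only [fermatCMType, mem_filter, mem_univ, true_and]; constructor <;> rintro ⟨h1, h2⟩ <;> exact ⟨h1, by omega⟩

/-- `H_{(a,b,c)} = H_{(c,b,a)}`. [cite: KoblitzRohrlich1978, §1 (p. 1184)] -/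
private theorem fermatCMType_swap₁₃ {m : ℕ} [NeZero m] (a b c : ZMod m) : fermatCMType m a b c = fermatCMType m c b a := by
  ext x; simp only [fermatCMType, mem_filter, mem_univ, true_and]; constructor <;> rintro ⟨h1, h2⟩ <;> exact ⟨h1, by omega⟩

/-- For `r′ + s′ + t′ = 0` modulo `N = pQ` and `p ∣ r′`: `p ∣ s′ ↔ p ∣ t′` ("Since g.c.d.`(r, s, t, r′, s′, t′) = 1`, we then have `p ∤ s′, t′`").
[cite: KoblitzRohrlich1978, §3 Case 1 (p. 1194)] -/
theorem dvd_val_iff_of_add_eq_zero {r' s' t' : ZMod (p * Q)} (h : r' + s' + t' = 0) (hr : p ∣ r'.val) : p ∣ s'.val ↔ p ∣ t'.val := by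
  have hsum0 : (((r'.val + s'.val + t'.val : ℕ)) : ZMod (p * Q)) = 0 := by
    push_cast; rw [ZMod.natCast_zmod_val, ZMod.natCast_zmod_val, ZMod.natCast_zmod_val, h]
  have hN : p * Q ∣ r'.val + s'.val + t'.val := (ZMod.natCast_eq_zero_iff _ _).1 hsum0
  have hp' : p ∣ r'.val + s'.val + t'.val := dvd_trans (dvd_mul_right p Q) hN
  rw [add_assoc, Nat.dvd_add_right hr] at hp'
  constructor
  · intro hs; exact (Nat.dvd_add_right hs).1 hp'
  · intro ht; exact (Nat.dvd_add_left ht).1 hp'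

/-- **KOBLITZ–ROHRLICH §3 PROPOSITION, CASE 1** ("Case 1. g.c.d.`(r, s, t, N) > 1`", pp. 1193–1195), at EVERY level `N = pQ` prime to
`6`, `p ≥ 5` prime: if `H_{(r,s,t)} = H_{(r′,s′,t′)}` for admissible triples (non-zero entries, `r + s + t = 0 = r′ + s′ + t′`) and `p`
divides `r, s, t` (representatives), then `p` divides `r′, s′, t′` as well — so under K–R's hypothesis g.c.d.`(r, s, t, r′, s′, t′) = 1`
Case 1 cannot occur.  (If `p` divides none of `r′, s′, t′`: §2; if it divides exactly one, w.l.o.g. `r′` by the symmetry of `H`: §4; it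
cannot divide exactly two.) [cite: KoblitzRohrlich1978, §3 Proposition, Case 1 (pp. 1193–1195)] -/
theorem dvd_of_fermatCMType_eq_of_dvd (hp : p.Prime) (hp5 : 5 ≤ p) (hN2 : Nat.Coprime 2 (p * Q)) (hN3 : Nat.Coprime 3 (p * Q))
    {r s t r' s' t' : ZMod (p * Q)} (hr : r ≠ 0) (hs : s ≠ 0) (ht : t ≠ 0) (hrst : r + s + t = 0)
    (hr' : r' ≠ 0) (hs' : s' ≠ 0) (ht' : t' ≠ 0) (hrst' : r' + s' + t' = 0)
    (hpr : p ∣ r.val) (hps : p ∣ s.val) (hpt : p ∣ t.val)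
    (hEq : fermatCMType (p * Q) r s t = fermatCMType (p * Q) r' s' t') :
    p ∣ r'.val ∧ p ∣ s'.val ∧ p ∣ t'.val := by
  by_cases h1 : p ∣ r'.val
  · by_cases h2 : p ∣ s'.val
    · exact ⟨h1, h2, (dvd_val_iff_of_add_eq_zero hrst' h1).1 h2⟩
    · have h3 : ¬p ∣ t'.val := fun h3 => h2 ((dvd_val_iff_of_add_eq_zero hrst' h1).2 h3)
      exact absurd hEq (fermatCMType_ne_of_dvd_of_dvd_of_not_dvd hp hp5 hN2 hN3 hrst' hr' hpr hps hpt h1 h2 h3)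
  · by_cases h2 : p ∣ s'.val
    · have hsrt : s' + r' + t' = 0 := by rw [add_comm s' r']; exact hrst'
      have h3 : ¬p ∣ t'.val := fun h3 => h1 ((dvd_val_iff_of_add_eq_zero hsrt h2).2 h3)
      exact absurd (hEq.trans (fermatCMType_swap₁₂ r' s' t'))
        (fermatCMType_ne_of_dvd_of_dvd_of_not_dvd hp hp5 hN2 hN3 hsrt hs' hpr hps hpt h2 h1 h3)
    · by_cases h3 : p ∣ t'.val
      · have htsr : t' + s' + r' = 0 := by rw [show t' + s' + r' = r' + s' + t' by ring]; exact hrst'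
        exact absurd (hEq.trans (fermatCMType_swap₁₃ r' s' t'))
          (fermatCMType_ne_of_dvd_of_dvd_of_not_dvd hp hp5 hN2 hN3 htsr ht' hpr hps hpt h3 h2 h1)
      · exact absurd hEq (fermatCMType_ne_of_dvd_of_not_dvd hp hp5 hr hs ht hrst hrst' hpr hps hpt h1 h2 h3)

/-- **The primes of the level are an invariant of `H`** (both directions of Case 1): at `N = pQ` prime to `6`, `p ≥ 5` prime, for
admissible triples with `H_{(r,s,t)} = H_{(r′,s′,t′)}`, `p` divides `r, s, t` iff it divides `r′, s′, t′` — the levels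
`M = N/g.c.d.(N, r, s, t)` and `M′` have the same prime divisors (cf. `dim L_{r,s,t} = φ(M)/2`).
[cite: KoblitzRohrlich1978, §3 Proposition, Case 1 (pp. 1193–1195) and §1 (p. 1183)] -/
theorem dvd_iff_dvd_of_fermatCMType_eq (hp : p.Prime) (hp5 : 5 ≤ p) (hN2 : Nat.Coprime 2 (p * Q)) (hN3 : Nat.Coprime 3 (p * Q))
    {r s t r' s' t' : ZMod (p * Q)} (hr : r ≠ 0) (hs : s ≠ 0) (ht : t ≠ 0) (hrst : r + s + t = 0)
    (hr' : r' ≠ 0) (hs' : s' ≠ 0) (ht' : t' ≠ 0) (hrst' : r' + s' + t' = 0)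
    (hEq : fermatCMType (p * Q) r s t = fermatCMType (p * Q) r' s' t') :
    (p ∣ r.val ∧ p ∣ s.val ∧ p ∣ t.val) ↔ (p ∣ r'.val ∧ p ∣ s'.val ∧ p ∣ t'.val) :=
  ⟨fun h => dvd_of_fermatCMType_eq_of_dvd hp hp5 hN2 hN3 hr hs ht hrst hr' hs' ht' hrst' h.1 h.2.1 h.2.2 hEq,
    fun h => dvd_of_fermatCMType_eq_of_dvd hp hp5 hN2 hN3 hr' hs' ht' hrst' hr hs ht hrst h.1 h.2.1 h.2.2 hEq.symm⟩

/-- **Case 1 eliminated** (the use K–R make of it: "To prove Theorem 1, it remains to establish the following proposition … Suppose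
g.c.d.`(r, s, t, r′, s′, t′) = 1` … Case 1. g.c.d.`(r, s, t, N) > 1`" leads to a contradiction): if no prime `p ≥ 5` with `N = pQ` divides
all six entries and `H_τ = H_{τ′}`, then `p` does not divide all of `r, s, t` — both triples are of exact level `N` at `p`.
[cite: KoblitzRohrlich1978, §3 Proposition, Case 1 (pp. 1193–1195)] -/
theorem not_dvd_of_fermatCMType_eq (hp : p.Prime) (hp5 : 5 ≤ p) (hN2 : Nat.Coprime 2 (p * Q)) (hN3 : Nat.Coprime 3 (p * Q))
    {r s t r' s' t' : ZMod (p * Q)} (hr : r ≠ 0) (hs : s ≠ 0) (ht : t ≠ 0) (hrst : r + s + t = 0)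
    (hr' : r' ≠ 0) (hs' : s' ≠ 0) (ht' : t' ≠ 0) (hrst' : r' + s' + t' = 0)
    (hgcd : ¬(p ∣ r.val ∧ p ∣ s.val ∧ p ∣ t.val ∧ p ∣ r'.val ∧ p ∣ s'.val ∧ p ∣ t'.val))
    (hEq : fermatCMType (p * Q) r s t = fermatCMType (p * Q) r' s' t') :
    ¬(p ∣ r.val ∧ p ∣ s.val ∧ p ∣ t.val) := fun h =>
  hgcd ⟨h.1, h.2.1, h.2.2, dvd_of_fermatCMType_eq_of_dvd hp hp5 hN2 hN3 hr hs ht hrst hr' hs' ht' hrst' h.1 h.2.1 h.2.2 hEq⟩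

end CaseOne

/-! ### Any level `N` prime to `6`, any prime `p ∣ N`; on abelian varieties -/

section AnyPrime

variable {N : ℕ} [NeZero N]

omit [NeZero N] in
/-- Every prime divisor of an `N` prime to `6` is `≥ 5`. [folklore] -/
private theorem five_le_of_prime_dvd (hN2 : Nat.Coprime 2 N) (hN3 : Nat.Coprime 3 N) {p : ℕ} (hp : p.Prime) (hpN : p ∣ N) : 5 ≤ p := by
  have h2 : p ≠ 2 := fun h => by rw [h] at hpN; exact absurd (Nat.Coprime.eq_one_of_dvd hN2 hpN) (by norm_num)
  have h3 : p ≠ 3 := fun h => by rw [h] at hpN; exact absurd (Nat.Coprime.eq_one_of_dvd hN3 hpN) (by norm_num)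
  have h4 : p ≠ 4 := fun h => by rw [h] at hp; exact absurd hp (by decide)
  have := hp.two_le
  omega

/-- **CASE 1 at any level `N` prime to `6` and any prime `p ∣ N`**: `H_{(r,s,t)} = H_{(r′,s′,t′)}` implies
`p ∣ r, s, t ⟺ p ∣ r′, s′, t′`. [cite: KoblitzRohrlich1978, §3 Proposition, Case 1 (pp. 1193–1195)] -/
theorem dvd_iff_dvd_of_fermatCMType_eq_of_prime_dvd (hN2 : Nat.Coprime 2 N) (hN3 : Nat.Coprime 3 N)
    {r s t r' s' t' : ZMod N} (hr : r ≠ 0) (hs : s ≠ 0) (ht : t ≠ 0) (hrst : r + s + t = 0)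
    (hr' : r' ≠ 0) (hs' : s' ≠ 0) (ht' : t' ≠ 0) (hrst' : r' + s' + t' = 0)
    (hEq : fermatCMType N r s t = fermatCMType N r' s' t') {p : ℕ} (hp : p.Prime) (hpN : p ∣ N) :
    (p ∣ r.val ∧ p ∣ s.val ∧ p ∣ t.val) ↔ (p ∣ r'.val ∧ p ∣ s'.val ∧ p ∣ t'.val) := by
  obtain ⟨Q, rfl⟩ := hpN
  exact dvd_iff_dvd_of_fermatCMType_eq hp (five_le_of_prime_dvd hN2 hN3 hp (dvd_mul_right p Q)) hN2 hN3
    hr hs ht hrst hr' hs' ht' hrst' hEq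

open Literature.AlgebraicGeometry.Motives (AbelianVariety)
open Literature.AlgebraicGeometry.HodgeTheory (complexBetti)
open Literature.AlgebraicGeometry.Pohlmann1968.Cyclotomic (cmTypeOfResidues)
open CyclotomicCMTypeResidueSets (IsCMResidueSet)
open NumberField

variable {L : Type} [Field L] [NumberField L] [IsCyclotomicExtension {N} ℚ L]
  {A A' : AbelianVariety ℂ} {ι : 𝓞 L →+* CategoryTheory.End A} {θ : L →+* Module.End ℂ (complexBetti A.X 1)}
  {ι' : 𝓞 L →+* CategoryTheory.End A'} {θ' : L →+* Module.End ℂ (complexBetti A'.X 1)}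

/-- A unit multiple has the same `p`-divisibility of its representative (`p ∣ N`). [folklore] -/
private theorem dvd_val_mul_iff_of_isUnit {p Q : ℕ} [NeZero (p * Q)] (hp : p.Prime) {u : ZMod (p * Q)} (hu : IsUnit u)
    (x : ZMod (p * Q)) : p ∣ (u * x).val ↔ p ∣ x.val :=
  ⟨fun h => by_contra fun hx => not_dvd_val_mul hp hu x hx h, fun h => dvd_val_mul_of_dvd u x h⟩

/-- **ON ABELIAN VARIETIES**: at a level `N` prime to `6`, if abelian varieties `A`, `A′` realising the (full-level) Fermat types
`Φ_{H_{(r,s,t)}}`, `Φ_{H_{(r′,s′,t′)}}` of `ℚ(ζ_N)` are ISOGENOUS, then every prime `p ∣ N` divides `r, s, t` iff it divides `r′, s′, t′` —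
Koblitz–Rohrlich's levels `M`, `M′` (their `L_{r,s,t} ⊂ ℂ^{φ(M)/2}`, `L_{r′,s′,t′} ⊂ ℂ^{φ(M′)/2}`) have the same prime divisors
(Shimura–Taniyama: `A ∼ A′ ⟺ H_{τ′} = H_{uτ}` for a unit `u`, tree `isIsogenous_fermatCMType_iff_exists_eq_mul`, then Case 1).
[cite: KoblitzRohrlich1978, §3 Proposition, Case 1 (pp. 1193–1195) and §1 (p. 1184)] [cite: Shimura1998, §6.1 Corollary and §8.4 Example (1)] -/
theorem dvd_iff_dvd_of_isIsogenous [IsCMField L] (hN2 : Nat.Coprime 2 N) (hN3 : Nat.Coprime 3 N)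
    {r s t r' s' t' : ZMod N} (hr : r ≠ 0) (hs : s ≠ 0) (ht : t ≠ 0) (hrst : r + s + t = 0)
    (hr' : r' ≠ 0) (hs' : s' ≠ 0) (ht' : t' ≠ 0) (hrst' : r' + s' + t' = 0)
    (hS : IsCMResidueSet N (fermatCMType N r s t)) (hS' : IsCMResidueSet N (fermatCMType N r' s' t'))
    (hA : IsCMTypeRealisation (cmTypeOfResidues (L := L) (fermatCMType N r s t) hS.cm) A ι θ)
    (hA' : IsCMTypeRealisation (cmTypeOfResidues (L := L) (fermatCMType N r' s' t') hS'.cm) A' ι' θ')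
    (hiso : AbelianVariety.IsIsogenous A A') {p : ℕ} (hp : p.Prime) (hpN : p ∣ N) :
    (p ∣ r.val ∧ p ∣ s.val ∧ p ∣ t.val) ↔ (p ∣ r'.val ∧ p ∣ s'.val ∧ p ∣ t'.val) := by
  obtain ⟨u, hu, hEq⟩ := (isIsogenous_fermatCMType_iff_exists_eq_mul hS hS' hA hA').1 hiso
  obtain ⟨Q, rfl⟩ := hpN
  have hur : u * r ≠ 0 := fun h => hr (hu.mul_right_eq_zero.1 h)
  have hus : u * s ≠ 0 := fun h => hs (hu.mul_right_eq_zero.1 h)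
  have hut : u * t ≠ 0 := fun h => ht (hu.mul_right_eq_zero.1 h)
  have hsum : u * r + u * s + u * t = 0 := by rw [← mul_add, ← mul_add, hrst, mul_zero]
  have key := dvd_iff_dvd_of_fermatCMType_eq hp (five_le_of_prime_dvd hN2 hN3 hp (dvd_mul_right p Q)) hN2 hN3
    hur hus hut hsum hr' hs' ht' hrst' hEq.symm
  rw [dvd_val_mul_iff_of_isUnit hp hu, dvd_val_mul_iff_of_isUnit hp hu, dvd_val_mul_iff_of_isUnit hp hu] at key
  exact key

end AnyPrime

/-! ## §6 THE LEVEL IS AN INVARIANT OF `H`: `H_τ = H_{τ′} ⟹ g.c.d.(N, r, s, t) = g.c.d.(N, r′, s′, t′)` (iterating Case 1 down the levels) -/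

section Level

/-- `(a : ℤ/pM) ≠ 0` with `a = p·a₁` forces `(a₁ : ℤ/M) ≠ 0`. [folklore] -/
private theorem natCast_div_ne_zero_lvl {p M a : ℕ} (_hp : 0 < p) (hpa : p ∣ a) (ha : (a : ZMod (p * M)) ≠ 0) :
    ((a / p : ℕ) : ZMod M) ≠ 0 := by
  intro h0
  rw [ZMod.natCast_eq_zero_iff] at h0
  apply ha
  rw [ZMod.natCast_eq_zero_iff, ← Nat.mul_div_cancel' hpa]
  exact Nat.mul_dvd_mul_left p h0

/-- `a + b + c ≡ 0 (mod pM)` with `p ∣ a, b, c` gives `a/p + b/p + c/p ≡ 0 (mod M)`. [folklore] -/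
private theorem natCast_div_sum_eq_zero_lvl {p M a b c : ℕ} (hp : 0 < p) (hpa : p ∣ a) (hpb : p ∣ b) (hpc : p ∣ c)
    (h : ((a : ZMod (p * M)) + b + c) = 0) : (((a / p : ℕ) : ZMod M) + (b / p : ℕ) + (c / p : ℕ)) = 0 := by
  rw [← Nat.cast_add, ← Nat.cast_add, ZMod.natCast_eq_zero_iff] at h ⊢
  have e : p * (a / p + b / p + c / p) = a + b + c := by
    rw [mul_add, mul_add, Nat.mul_div_cancel' hpa, Nat.mul_div_cancel' hpb, Nat.mul_div_cancel' hpc]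
  rw [← e] at h
  exact Nat.dvd_of_mul_dvd_mul_left hp h

/-- `gcd(pM, pa, pb, pc) = p·gcd(M, a, b, c)`. [folklore] -/
private theorem gcd_mul_level (p M a b c : ℕ) :
    (((p * M).gcd (p * a)).gcd (p * b)).gcd (p * c) = p * (((M.gcd a).gcd b).gcd c) := by
  rw [Nat.gcd_mul_left, Nat.gcd_mul_left, Nat.gcd_mul_left]

/-- **The level divides the level**, on natural-number entries, by strong induction on `N`: for `N` prime to `6` and admissible triples of
naturals with `H_{(a,b,c)} = H_{(a′,b′,c′)}` modulo `N`, `gcd(N, a, b, c) ∣ gcd(N, a′, b′, c′)` — a prime `p` of `gcd(N, a, b, c)` divides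
`a′, b′, c′` by CASE 1, both triples are `p`-multiples, the equality descends to level `N/p` (sibling `fermatCMType_eq_of_fermatCMType_level_mul_eq`),
and the induction hypothesis applies there. [cite: KoblitzRohrlich1978, §3 Proposition, Case 1 (pp. 1193–1195) and §1 (pp. 1183–1184)] -/
theorem gcd_dvd_gcd_of_fermatCMType_eq_nat (N : ℕ) : ∀ [NeZero N], Nat.Coprime 2 N → Nat.Coprime 3 N →
    ∀ {a b c a' b' c' : ℕ}, (a : ZMod N) ≠ 0 → (b : ZMod N) ≠ 0 → (c : ZMod N) ≠ 0 → ((a : ZMod N) + b + c) = 0 →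
    (a' : ZMod N) ≠ 0 → (b' : ZMod N) ≠ 0 → (c' : ZMod N) ≠ 0 → ((a' : ZMod N) + b' + c') = 0 →
    fermatCMType N (a : ZMod N) (b : ZMod N) (c : ZMod N) = fermatCMType N (a' : ZMod N) (b' : ZMod N) (c' : ZMod N) →
    ((N.gcd a).gcd b).gcd c ∣ ((N.gcd a').gcd b').gcd c' := by
  induction N using Nat.strong_induction_on with
  | _ N ih =>
    intro _ hN2 hN3 a b c a' b' c' ha hb hc habc ha' hb' hc' habc' hEq
    set g := ((N.gcd a).gcd b).gcd c with hg
    by_cases hg1 : g = 1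
    · exact hg1 ▸ one_dvd _
    obtain ⟨p, hp, hpg⟩ := Nat.exists_prime_and_dvd hg1
    have hpN : p ∣ N := dvd_trans hpg (dvd_trans (Nat.gcd_dvd_left _ _) (dvd_trans (Nat.gcd_dvd_left _ _) (Nat.gcd_dvd_left _ _)))
    have hpa : p ∣ a := dvd_trans hpg (dvd_trans (Nat.gcd_dvd_left _ _) (dvd_trans (Nat.gcd_dvd_left _ _) (Nat.gcd_dvd_right _ _)))
    have hpb : p ∣ b := dvd_trans hpg (dvd_trans (Nat.gcd_dvd_left _ _) (Nat.gcd_dvd_right _ _))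
    have hpc : p ∣ c := dvd_trans hpg (Nat.gcd_dvd_right _ _)
    obtain ⟨M, rfl⟩ := hpN
    haveI : NeZero M := ⟨fun h => NeZero.ne (p * M) (by rw [h, mul_zero])⟩
    have hp5 : 5 ≤ p := five_le_of_prime_dvd hN2 hN3 hp (dvd_mul_right p M)
    -- CASE 1: `p` divides `a′, b′, c′` too (on representatives `x.val = x % N`, equivalently on the naturals as `p ∣ N`)
    have hdvd : ∀ x : ℕ, p ∣ x ↔ p ∣ ((x : ℕ) : ZMod (p * M)).val := fun x => by
      rw [ZMod.val_natCast]; exact (Nat.dvd_mod_iff (dvd_mul_right p M)).symm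
    obtain ⟨hpa', hpb', hpc'⟩ := dvd_of_fermatCMType_eq_of_dvd hp hp5 hN2 hN3 ha hb hc habc ha' hb' hc' habc'
      ((hdvd a).1 hpa) ((hdvd b).1 hpb) ((hdvd c).1 hpc) hEq
    rw [← hdvd] at hpa' hpb' hpc'
    -- descend to level `M`
    have hM2 : Nat.Coprime 2 M := Nat.Coprime.coprime_dvd_right (dvd_mul_left M p) hN2
    have hM3 : Nat.Coprime 3 M := Nat.Coprime.coprime_dvd_right (dvd_mul_left M p) hN3
    have hMlt : M < p * M := lt_mul_of_one_lt_left (Nat.pos_of_ne_zero (NeZero.ne M)) hp.one_lt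
    have key : ∀ x : ℕ, p ∣ x → ((x : ℕ) : ZMod (p * M)) = ((p * (x / p) : ℕ) : ZMod (p * M)) := fun x hx => by
      rw [Nat.mul_div_cancel' hx]
    rw [key a hpa, key b hpb, key c hpc, key a' hpa', key b' hpb', key c' hpc'] at hEq
    have hEqM := fermatCMType_eq_of_fermatCMType_level_mul_eq hp.pos hEq.symm
    have hI := ih M hMlt hM2 hM3 (natCast_div_ne_zero_lvl hp.pos hpa ha) (natCast_div_ne_zero_lvl hp.pos hpb hb)
      (natCast_div_ne_zero_lvl hp.pos hpc hc) (natCast_div_sum_eq_zero_lvl hp.pos hpa hpb hpc habc)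
      (natCast_div_ne_zero_lvl hp.pos hpa' ha') (natCast_div_ne_zero_lvl hp.pos hpb' hb') (natCast_div_ne_zero_lvl hp.pos hpc' hc')
      (natCast_div_sum_eq_zero_lvl hp.pos hpa' hpb' hpc' habc') hEqM.symm
    rw [hg, ← Nat.mul_div_cancel' hpa, ← Nat.mul_div_cancel' hpb, ← Nat.mul_div_cancel' hpc, ← Nat.mul_div_cancel' hpa',
      ← Nat.mul_div_cancel' hpb', ← Nat.mul_div_cancel' hpc', gcd_mul_level, gcd_mul_level]
    exact Nat.mul_dvd_mul_left p hI

variable {N : ℕ} [NeZero N]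

/-- **THE LEVEL IS AN INVARIANT OF `H`**: at every level `N` prime to `6`, admissible triples `τ, τ′` with `H_τ = H_{τ′}` have the same
g.c.d. with `N` — `g.c.d.(N, r, s, t) = g.c.d.(N, r′, s′, t′)`, i.e. the same Koblitz–Rohrlich level `M = N/g.c.d.` (so that their lattices
`L_τ ⊂ ℂ^{φ(M)/2}`, `L_{τ′} ⊂ ℂ^{φ(M′)/2}` have the same dimension; cf. "the assumptions of the proposition … g.c.d.`(r, s, t, r′, s′, t′) = 1`").
[cite: KoblitzRohrlich1978, §3 Proposition, Case 1 (pp. 1193–1195) and §1 (pp. 1183–1184)] -/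
theorem gcd_eq_gcd_of_fermatCMType_eq (hN2 : Nat.Coprime 2 N) (hN3 : Nat.Coprime 3 N)
    {r s t r' s' t' : ZMod N} (hr : r ≠ 0) (hs : s ≠ 0) (ht : t ≠ 0) (hrst : r + s + t = 0)
    (hr' : r' ≠ 0) (hs' : s' ≠ 0) (ht' : t' ≠ 0) (hrst' : r' + s' + t' = 0)
    (hEq : fermatCMType N r s t = fermatCMType N r' s' t') :
    ((N.gcd r.val).gcd s.val).gcd t.val = ((N.gcd r'.val).gcd s'.val).gcd t'.val := by
  have e : ∀ x : ZMod N, ((x.val : ℕ) : ZMod N) = x := fun x => ZMod.natCast_zmod_val x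
  have h1 := gcd_dvd_gcd_of_fermatCMType_eq_nat N hN2 hN3 (a := r.val) (b := s.val) (c := t.val) (a' := r'.val) (b' := s'.val)
    (c' := t'.val) (by rw [e]; exact hr) (by rw [e]; exact hs) (by rw [e]; exact ht) (by rw [e, e, e]; exact hrst)
    (by rw [e]; exact hr') (by rw [e]; exact hs') (by rw [e]; exact ht') (by rw [e, e, e]; exact hrst') (by rw [e, e, e, e, e, e]; exact hEq)
  have h2 := gcd_dvd_gcd_of_fermatCMType_eq_nat N hN2 hN3 (a := r'.val) (b := s'.val) (c := t'.val) (a' := r.val) (b' := s.val)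
    (c' := t.val) (by rw [e]; exact hr') (by rw [e]; exact hs') (by rw [e]; exact ht') (by rw [e, e, e]; exact hrst')
    (by rw [e]; exact hr) (by rw [e]; exact hs) (by rw [e]; exact ht) (by rw [e, e, e]; exact hrst) (by rw [e, e, e, e, e, e]; exact hEq.symm)
  exact Nat.dvd_antisymm h1 h2

open Literature.AlgebraicGeometry.Motives (AbelianVariety)
open Literature.AlgebraicGeometry.HodgeTheory (complexBetti)
open Literature.AlgebraicGeometry.Pohlmann1968.Cyclotomic (cmTypeOfResidues)
open CyclotomicCMTypeResidueSets (IsCMResidueSet)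
open NumberField

/-- A unit multiple has the same g.c.d. with any divisor `g` of the level. [folklore] -/
private theorem gcd_val_mul_of_isUnit {g : ℕ} (hg : g ∣ N) {u : ZMod N} (hu : IsUnit u) (x : ZMod N) :
    g.gcd (u * x).val = g.gcd x.val := by
  have hc : Nat.Coprime u.val g := Nat.Coprime.coprime_dvd_right hg ((isUnit_iff_val_coprime_bc u).1 hu)
  rw [ZMod.val_mul, Nat.gcd_rec, Nat.mod_mod_of_dvd _ hg, ← Nat.gcd_rec, Nat.gcd_comm, Nat.Coprime.gcd_mul_left_cancel x.val hc,
    Nat.gcd_comm]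

variable {L : Type} [Field L] [NumberField L] [IsCyclotomicExtension {N} ℚ L]
  {A A' : AbelianVariety ℂ} {ι : 𝓞 L →+* CategoryTheory.End A} {θ : L →+* Module.End ℂ (complexBetti A.X 1)}
  {ι' : 𝓞 L →+* CategoryTheory.End A'} {θ' : L →+* Module.End ℂ (complexBetti A'.X 1)}

/-- **THE LEVEL IS AN ISOGENY INVARIANT** of the full-level Fermat varieties: at `N` prime to `6`, if realisations of `Φ_{H_τ}`, `Φ_{H_{τ′}}`
of `ℚ(ζ_N)` are isogenous then `g.c.d.(N, r, s, t) = g.c.d.(N, r′, s′, t′)` — Koblitz–Rohrlich's `L_τ` and `L_{τ′}` live in the same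
`ℂ^{φ(M)/2}` over the same `ℚ(ζ_M)` (with the sibling `exists_isIsogeny_power_level_mul`: both varieties are `φ(N)/φ(M)`-th powers of
`φ(M)/2`-dimensional ones). [cite: KoblitzRohrlich1978, §3 Proposition, Case 1 (pp. 1193–1195) and §1 (pp. 1183–1184)]
[cite: Shimura1998, §6.1 Corollary and §8.4 Example (1)] -/
theorem gcd_eq_gcd_of_isIsogenous [IsCMField L] (hN2 : Nat.Coprime 2 N) (hN3 : Nat.Coprime 3 N)
    {r s t r' s' t' : ZMod N} (hr : r ≠ 0) (hs : s ≠ 0) (ht : t ≠ 0) (hrst : r + s + t = 0)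
    (hr' : r' ≠ 0) (hs' : s' ≠ 0) (ht' : t' ≠ 0) (hrst' : r' + s' + t' = 0)
    (hS : IsCMResidueSet N (fermatCMType N r s t)) (hS' : IsCMResidueSet N (fermatCMType N r' s' t'))
    (hA : IsCMTypeRealisation (cmTypeOfResidues (L := L) (fermatCMType N r s t) hS.cm) A ι θ)
    (hA' : IsCMTypeRealisation (cmTypeOfResidues (L := L) (fermatCMType N r' s' t') hS'.cm) A' ι' θ')
    (hiso : AbelianVariety.IsIsogenous A A') :
    ((N.gcd r.val).gcd s.val).gcd t.val = ((N.gcd r'.val).gcd s'.val).gcd t'.val := by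
  obtain ⟨u, hu, hEq⟩ := (isIsogenous_fermatCMType_iff_exists_eq_mul hS hS' hA hA').1 hiso
  have hur : u * r ≠ 0 := fun h => hr (hu.mul_right_eq_zero.1 h)
  have hus : u * s ≠ 0 := fun h => hs (hu.mul_right_eq_zero.1 h)
  have hut : u * t ≠ 0 := fun h => ht (hu.mul_right_eq_zero.1 h)
  have hsum : u * r + u * s + u * t = 0 := by rw [← mul_add, ← mul_add, hrst, mul_zero]
  have key := gcd_eq_gcd_of_fermatCMType_eq hN2 hN3 hur hus hut hsum hr' hs' ht' hrst' hEq.symm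
  rwa [gcd_val_mul_of_isUnit dvd_rfl hu, gcd_val_mul_of_isUnit (Nat.gcd_dvd_left _ _) hu,
    gcd_val_mul_of_isUnit (dvd_trans (Nat.gcd_dvd_left _ _) (Nat.gcd_dvd_left _ _)) hu] at key

end Level

end CyclotomicFermatCMType

end Literature.AlgebraicGeometry.ComplexMultiplication
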